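import Literature.AlgebraicGeometry.Modules.ModulesGrothendieckAbelian
import Mathlib.Topology.Sheaves.Flasque
import Mathlib.CategoryTheory.Preadditive.Injective.Basic
import Mathlib.Algebra.Category.Grp.EpiMono
import HarnessLib

/-!
# Injective sheaves of modules are flasque (Hartshorne III.2.4 for ringed spaces)

For a sheaf of rings `R` on a topological space `X` (e.g. the structure sheaf of a scheme), every
INJECTIVE object `ℐ` of the category of sheaves of `R`-modules is FLASQUE: all restriction maps
`ℐ(U) → ℐ(V)` (`V ⊆ U`) are surjective (R. Hartshorne, *Algebraic Geometry*, III Lemma 2.4: "If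
`(X, 𝒪_X)` is a ringed space, then any injective `𝒪_X`-module is flasque"). The printed proof is
followed verbatim, with the free sheaves of modules on representables
`freeYonedaModule R U = j_!(𝒪_U)` of `Modules/ModulesGrothendieckAbelian.lean` in the role of
`𝒪_U = j_!(𝒪_X|_U)`: `Hom(j_!𝒪_U, ℐ) = ℐ(U)` (`freeYonedaModuleHomEquiv`), compatibly with the
monomorphism `j_!𝒪_V ↪ j_!𝒪_U` and restriction (`freeYonedaModuleHomEquiv_map_comp`,
`mono_sheafification_map_free_map`), so injectivity of `ℐ` extends every section over `V` to `U`.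

* `PresheafOfModules.freeYonedaEquiv_apply`, `PresheafOfModules.freeYonedaEquiv_free_map_comp` —
  naturality of Mathlib's `PresheafOfModules.freeYonedaEquiv` in the representing object;
* `freeYonedaModuleHomEquiv_map_comp`, `mono_sheafification_map_free_map` — the same for the free
  SHEAVES of modules, and `j_!𝒪_V ↪ j_!𝒪_U` for a mono `V ⟶ U` of the site;
* `SheafOfModules.map_surjective_of_injective` — sections of an injective sheaf of modules extend
  along monomorphisms of the site (any site);
* `isFlasque_toSheaf_of_injective` (**Hartshorne III.2.4**) — on a topological space, the
  underlying abelian sheaf of an injective sheaf of modules is flasque (Mathlib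
  `TopCat.Sheaf.IsFlasque`); `isFlasque_of_injective_modules` — the case of `X.Modules` for a
  scheme `X` (with `injective_sheafOfModules_of_injective` bridging Mathlib's two defeq category
  instances on `X.Modules`).

The abelian-sheaf case (`(X, ℤ)`) is `Motives.isFlasque_of_injective` (`Motives/FlasqueCohomology`).

## References

* R. Hartshorne, *Algebraic Geometry*, GTM 52 (1977), III Lemma 2.4 (p. 207). [Hartshorne1977]
* The Stacks Project, Tag 01EA (injective modules are flasque). [StacksProject]
-/

universe u

open CategoryTheory CategoryTheory.Limits Opposite AlgebraicGeometry

namespace Literature.AlgebraicGeometry.Modules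

section FreeYonedaMap

variable {C : Type u} [Category.{u} C] {J : GrothendieckTopology C} (R : Sheaf J RingCat.{u})
  [HasSheafify J AddCommGrpCat.{u}] [J.WEqualsLocallyBijective AddCommGrpCat.{u}]

/-- Mathlib's `PresheafOfModules.freeYonedaEquiv` evaluates a morphism out of the free presheaf of
modules on `h_U` at the basis element `𝟙 U`. [folklore] -/
theorem PresheafOfModules.freeYonedaEquiv_apply {R₀ : Cᵒᵖ ⥤ RingCat.{u}}
    {N : PresheafOfModules.{u} R₀} {U : C}
    (χ : (PresheafOfModules.free R₀).obj (yoneda.obj U) ⟶ N) :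
    PresheafOfModules.freeYonedaEquiv χ = χ.app (op U) (ModuleCat.freeMk (𝟙 U)) := by
  have h := PresheafOfModules.freeYonedaEquiv_symm_app N U (PresheafOfModules.freeYonedaEquiv χ)
  rw [Equiv.symm_apply_apply] at h
  exact h.symm

/-- Naturality of Mathlib's `PresheafOfModules.freeYonedaEquiv` in the representing object:
precomposition with the map of free presheaves of modules induced by `i : V ⟶ U` is the restriction
map `N(U) → N(V)`. [folklore] -/
theorem PresheafOfModules.freeYonedaEquiv_free_map_comp {R₀ : Cᵒᵖ ⥤ RingCat.{u}}
    {N : PresheafOfModules.{u} R₀} {V U : C} (i : V ⟶ U)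
    (χ : (PresheafOfModules.free R₀).obj (yoneda.obj U) ⟶ N) :
    PresheafOfModules.freeYonedaEquiv ((PresheafOfModules.free R₀).map (yoneda.map i) ≫ χ) =
      N.map i.op (PresheafOfModules.freeYonedaEquiv χ) := by
  rw [PresheafOfModules.freeYonedaEquiv_apply, PresheafOfModules.freeYonedaEquiv_apply,
    ← PresheafOfModules.naturality_apply, PresheafOfModules.comp_app]
  change χ.app (op V) (((PresheafOfModules.free R₀).map (yoneda.map i)).app (op V)
    (ModuleCat.freeMk (𝟙 V))) = χ.app (op V) _
  congr 1
  rw [PresheafOfModules.free_map_app]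
  erw [ModuleCat.free_map_apply, PresheafOfModules.freeObj_map, ModuleCat.freeDesc_apply]
  exact congrArg ModuleCat.freeMk ((Category.id_comp i).trans (Category.comp_id i).symm)

/-- **Restriction = precomposition with `j_!𝒪_V ↪ j_!𝒪_U`**: under `freeYonedaModuleHomEquiv`,
precomposing `ψ : freeYonedaModule R U ⟶ M` with the map of free sheaves of modules induced by
`i : V ⟶ U` gives the restriction `M(U) → M(V)` of the section corresponding to `ψ`
(Hartshorne III.2, proof of 2.4: `Hom(𝒪_U, ℐ) = ℐ(U)` compatibly with `𝒪_V ↪ 𝒪_U`). [folklore] -/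
theorem freeYonedaModuleHomEquiv_map_comp {V U : C} (i : V ⟶ U) {M : SheafOfModules.{u} R}
    (ψ : freeYonedaModule R U ⟶ M) :
    freeYonedaModuleHomEquiv R
        ((show freeYonedaModule R V ⟶ freeYonedaModule R U from
          (PresheafOfModules.sheafification (𝟙 R.obj)).map
            ((PresheafOfModules.free R.obj).map (yoneda.map i))) ≫ ψ) =
      M.val.map i.op (freeYonedaModuleHomEquiv R ψ) := by
  change PresheafOfModules.freeYonedaEquiv
      ((PresheafOfModules.sheafificationAdjunction (𝟙 R.obj)).homEquiv _ M
        ((PresheafOfModules.sheafification (𝟙 R.obj)).map _ ≫ ψ)) =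
    M.val.map i.op (PresheafOfModules.freeYonedaEquiv
      ((PresheafOfModules.sheafificationAdjunction (𝟙 R.obj)).homEquiv _ M ψ))
  rw [Adjunction.homEquiv_naturality_left, PresheafOfModules.freeYonedaEquiv_free_map_comp]
  rfl

/-- For a monomorphism `i : V ⟶ U` of the site, the induced map of free sheaves of modules
`freeYonedaModule R V ⟶ freeYonedaModule R U` is a monomorphism (objectwise, before sheafification,
it is the map of free modules induced by the injection `(· ≫ i)` of bases; sheafification is exact).
For opens `V ⊆ U` of a ringed space: `j_!𝒪_V ↪ j_!𝒪_U`. [folklore] -/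
theorem mono_sheafification_map_free_map {V U : C} (i : V ⟶ U) [Mono i] :
    Mono (X := freeYonedaModule R V) (Y := freeYonedaModule R U)
      ((PresheafOfModules.sheafification (𝟙 R.obj)).map
        ((PresheafOfModules.free R.obj).map (yoneda.map i))) := by
  haveI : Mono ((PresheafOfModules.free R.obj).map (yoneda.map i)) := by
    refine PresheafOfModules.mono_of_injective (fun W => ?_)
    change Function.Injective ((ModuleCat.free (R.obj.obj W)).map ((yoneda.map i).app W))
    change Function.Injective (Finsupp.mapDomain ((yoneda.map i).app W))
    exact Finsupp.mapDomain_injective (fun a b h => (cancel_mono i).mp h)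
  change Mono ((PresheafOfModules.sheafification (𝟙 R.obj)).map _)
  infer_instance

/-- **Sections of an injective sheaf of modules extend along monomorphisms of the site**: if `ℐ` is
an injective object of `SheafOfModules R` and `i : V ⟶ U` is a monomorphism, the restriction
`ℐ(U) → ℐ(V)` is surjective — every `s ∈ ℐ(V)` is a morphism `j_!𝒪_V → ℐ`, which extends along
the mono `j_!𝒪_V ↪ j_!𝒪_U` by injectivity (Hartshorne III.2.4, for `𝒪`-modules).
[cite: Hartshorne1977, III.2.4] -/
theorem SheafOfModules.map_surjective_of_injective (I : SheafOfModules.{u} R) [Injective I]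
    {V U : C} (i : V ⟶ U) [Mono i] : Function.Surjective (I.val.map i.op) := by
  intro s
  haveI := mono_sheafification_map_free_map R i
  obtain ⟨ψ, hψ⟩ := Injective.factors ((freeYonedaModuleHomEquiv R).symm s)
    (show freeYonedaModule R V ⟶ freeYonedaModule R U from
      (PresheafOfModules.sheafification (𝟙 R.obj)).map
        ((PresheafOfModules.free R.obj).map (yoneda.map i)))
  refine ⟨freeYonedaModuleHomEquiv R ψ, ?_⟩
  rw [← freeYonedaModuleHomEquiv_map_comp, hψ, Equiv.apply_symm_apply]

end FreeYonedaMap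

section Flasque

variable {X : TopCat.{u}} (R : Sheaf (Opens.grothendieckTopology X) RingCat.{u})

/-- **Injective sheaves of modules are flasque** (Hartshorne III.2.4: "if `(X, 𝒪_X)` is a ringed
space, any injective `𝒪_X`-module is flasque"): the underlying abelian sheaf of an injective object
of `SheafOfModules R`, `R` a sheaf of rings on a topological space, is flasque.
[cite: Hartshorne1977, III.2.4] -/
theorem isFlasque_toSheaf_of_injective (I : SheafOfModules.{u} R) [Injective I] :
    TopCat.Sheaf.IsFlasque ((SheafOfModules.toSheaf R).obj I) where
  epi {U V} i := by
    rw [AddCommGrpCat.epi_iff_surjective]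
    intro s
    obtain ⟨t, ht⟩ := SheafOfModules.map_surjective_of_injective R I i.unop s
    exact ⟨t, ht⟩

end Flasque

section Scheme

variable {X : Scheme.{u}}

/-- An injective object of `X.Modules` is an injective object of the (definitionally equal)
category `SheafOfModules X.ringCatSheaf` — Mathlib's `X.Modules` carries its own (defeq) category
instance, across which typeclass search does not see. [folklore] -/
theorem injective_sheafOfModules_of_injective (I : X.Modules) [hI : Injective I] :
    @Injective (SheafOfModules.{u} X.ringCatSheaf) _ I where
  factors {A B} g f hf :=
    @Injective.factors X.Modules _ I hI A B g f ⟨fun u v huv => hf.right_cancellation u v huv⟩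

/-- **Injective `𝒪_X`-modules on a scheme are flasque** (Hartshorne III.2.4), for Mathlib's
`X.Modules` and the forgetful functor `SheafOfModules.toSheaf` to abelian sheaves.
[cite: Hartshorne1977, III.2.4] -/
theorem isFlasque_of_injective_modules (I : X.Modules) [Injective I] :
    TopCat.Sheaf.IsFlasque ((SheafOfModules.toSheaf X.ringCatSheaf).obj I) :=
  haveI := injective_sheafOfModules_of_injective I
  isFlasque_toSheaf_of_injective (X := X.carrier) X.ringCatSheaf I

end Scheme

end Literature.AlgebraicGeometry.Modules
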